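import Literature.Probability.RandomPlanarGeometry.HexSAWLemma2
import Literature.Probability.RandomPlanarGeometry.HexSAWLowerBound
import HarnessLib

/-!
# Duminil-Copin–Smirnov §3: the unconditional escape-mass lower bound `B_T + c_ε E_T ≥ m/T`

Topic `Literature/Probability/RandomPlanarGeometry`. Source: H. Duminil-Copin, S. Smirnov, *The connective
constant of the honeycomb lattice equals `√(2+√2)`*, Ann. of Math. 175 (2012), 1653–1665 (arXiv:1007.0575),
§3, proof of Theorem 1: the identity `1 = c_α A_T + B_T + c_ε E_T` (eq. (4)), the cutting inequality
`A_{T+1} − A_T ≤ x_c⁻¹ (B_{T+1})²` (eq. (6)) and the induction "`B_T ≥ min[B_1, 1/(c_α x_c⁻¹)]/T`".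

In the paper (and in `HexSAWLowerBound.lean`, `stripBlim_ge`) the induction for `B_T` is run inside the proof
by contradiction of `Z(x_c) = +∞`, i.e. under the hypothesis `Σₙ cₙ x_cⁿ < ∞`, which is what forces `E_T = 0`
and turns (4) into `1 = c_α A_T + B_T` (eq. (5)). This file records the UNCONDITIONAL content of the same
argument: the ESCAPE MASS `G_T := 1 − c_α A_T = B_T + c_ε E_T` (walks from the root leaving the strip `S_T`
through the far side, plus `c_ε` times those leaving the trapezoids through the oblique sides, in the limit
`L → ∞`) satisfies the same recursion `G_T ≤ G_{T+1} + (c_α/x_c) G_{T+1}²` with no summability hypothesis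
(because `B_{T+1} ≤ G_{T+1}`), hence `G_T ≥ m/T` with `m = min(G_1, x_c/c_α) > 0`, and, for every finite
trapezoid `S_{T,L}`, `B_{T,L} + c_ε E_{T,L} = 1 − c_α A_{T,L} ≥ m/T`.

This is the only polynomial (in `1/T`) lower bound on critical boundary-rooted SAW masses at distance `T`
that the present tools give; it is SUMMED over the `≍ T + L` exit mid-edges (the pointwise two-point lower
bound is open, cf. the crux notes of `Summits/CriticalPhenomena/SAWScalingLimit/Cruxes/MassRatio`).

## Contents (namespace `Literature.Probability.RandomPlanarGeometry.SAW`, all at `x = x_c`, Lemma 2 discharged)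
* `stripBlim_nonneg`, `stripBlim_le_escape` (`0 ≤ B_T ≤ G_T`);
* `escape_le_succ` (the recursion), `escape_one_pos` (`G_1 > 0`), `escape_ge` (`G_{T+1} ≥ m/(T+1)`);
* `strip_escape_ge` (finite form: `B_{T,L} + c_ε E_{T,L} ≥ m/T` for all `T ≥ 1`, `L`).
-/

noncomputable section

namespace Literature.Probability.RandomPlanarGeometry.SAW

open HV

/-- `B_T ≥ 0` (limit bridge partition function of the strip `S_T` at `x_c`). [cite: DuminilCopinSmirnov2012, §3] -/
theorem stripBlim_nonneg {T : ℕ} (hT : 1 ≤ T) : 0 ≤ stripBlim T :=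
  (stripB_nonneg hexCriticalFugacity_pos_lt_one.1.le).trans
    (stripB_le_lim DuminilCopinSmirnov2012_lemma2_holds hT 0)

/-- `B_T ≤ G_T := 1 − c_α A_T` (`= B_T + c_ε E_T`, `E_T ≥ 0`). [cite: DuminilCopinSmirnov2012, §3, eq. (4)] -/
theorem stripBlim_le_escape {T : ℕ} (hT : 1 ≤ T) :
    stripBlim T ≤ 1 - Real.cos (3 * Real.pi / 8) * stripAlim T := by
  have h := lemma2_lim T
  have hE := stripElim_nonneg DuminilCopinSmirnov2012_lemma2_holds hT
  have hc := cos_pi_div_four_pos'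
  nlinarith

/-- **The escape-mass recursion, unconditional:** `G_T ≤ G_{T+1} + (c_α/x_c) G_{T+1}²` for
`G_T = 1 − c_α A_T` (from the cutting inequality (6) and `B_{T+1} ≤ G_{T+1}`; no `E_T = 0` needed).
[cite: DuminilCopinSmirnov2012, §3, eqs. (4), (6)] -/
theorem escape_le_succ {T : ℕ} (hT : 1 ≤ T) :
    1 - Real.cos (3 * Real.pi / 8) * stripAlim T ≤
      (1 - Real.cos (3 * Real.pi / 8) * stripAlim (T + 1)) +
        Real.cos (3 * Real.pi / 8) * hexCriticalFugacity⁻¹ *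
          (1 - Real.cos (3 * Real.pi / 8) * stripAlim (T + 1)) ^ 2 := by
  have h3 := stripAlim_succ_le DuminilCopinSmirnov2012_lemma2_holds hT
  have hB0 := stripBlim_nonneg (T := T + 1) (by omega)
  have hBG := stripBlim_le_escape (T := T + 1) (by omega)
  have hc := cos_three_pi_div_eight_pos
  have hx : 0 < hexCriticalFugacity⁻¹ := inv_pos.2 hexCriticalFugacity_pos_lt_one.1
  have hsq : stripBlim (T + 1) ^ 2 ≤ (1 - Real.cos (3 * Real.pi / 8) * stripAlim (T + 1)) ^ 2 :=
    pow_le_pow_left₀ hB0 hBG 2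
  have h4 := mul_le_mul_of_nonneg_left h3 hc.le
  have h5 := mul_le_mul_of_nonneg_left hsq (mul_pos hc hx).le
  nlinarith

/-- `G_1 > 0` (`G_1 ≥ B_1 ≥ x_c²`). [cite: DuminilCopinSmirnov2012, §3 ("B_1 > 0")] -/
theorem escape_one_pos : 0 < 1 - Real.cos (3 * Real.pi / 8) * stripAlim 1 :=
  (stripBlim_one_pos DuminilCopinSmirnov2012_lemma2_holds).trans_le (stripBlim_le_escape le_rfl)

/-- **Unconditional polynomial escape bound** ("it follows easily by induction"), for the escape mass
instead of the bridge mass: `G_{T+1} = 1 − c_α A_{T+1} ≥ min(G_1, x_c/c_α)/(T+1)` for every `T`.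
[cite: DuminilCopinSmirnov2012, §3 (proof of Theorem 1, the induction for B_T)] -/
theorem escape_ge (T : ℕ) :
    min (1 - Real.cos (3 * Real.pi / 8) * stripAlim 1)
        (Real.cos (3 * Real.pi / 8) * hexCriticalFugacity⁻¹)⁻¹ / (T + 1) ≤
      1 - Real.cos (3 * Real.pi / 8) * stripAlim (T + 1) := by
  set κ := Real.cos (3 * Real.pi / 8) * hexCriticalFugacity⁻¹ with hκ
  set G : ℕ → ℝ := fun n => 1 - Real.cos (3 * Real.pi / 8) * stripAlim n with hG
  set m := min (G 1) κ⁻¹ with hm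
  have hκpos : 0 < κ := mul_pos cos_three_pi_div_eight_pos (inv_pos.2 hexCriticalFugacity_pos_lt_one.1)
  have hmpos : 0 < m := lt_min escape_one_pos (inv_pos.2 hκpos)
  have hmκ : m * κ ≤ 1 := by
    rw [← le_div_iff₀ hκpos, one_div]; exact min_le_right _ _
  show m / (T + 1) ≤ G (T + 1)
  induction T with
  | zero => simp [hm]
  | succ T ih =>
    have hrec : G (T + 1) ≤ G (T + 1 + 1) + κ * G (T + 1 + 1) ^ 2 := escape_le_succ (by omega)
    have hGpos : 0 ≤ G (T + 1 + 1) :=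
      (stripBlim_nonneg (T := T + 1 + 1) (by omega)).trans (stripBlim_le_escape (by omega))
    by_contra hlt
    push Not at hlt
    have hT0 : (0 : ℝ) < T + 1 := by positivity
    have hT1 : (0 : ℝ) < T + 1 + 1 := by positivity
    push_cast at hrec hlt ih
    -- `y ↦ y + κ y²` is increasing on `y ≥ 0`, so `G_{T+1} < f(m/(T+2))`
    have key : G (T + 1) < m / (T + 1 + 1) + κ * (m / (T + 1 + 1)) ^ 2 := by
      have hsq : G (T + 1 + 1) ^ 2 ≤ (m / (T + 1 + 1)) ^ 2 := pow_le_pow_left₀ hGpos hlt.le 2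
      have := mul_le_mul_of_nonneg_left hsq hκpos.le
      linarith
    -- and `f(m/(T+2)) ≤ m/(T+1)` since `κ m ≤ 1`
    have key2 : m / (T + 1 + 1) + κ * (m / (T + 1 + 1)) ^ 2 ≤ m / (T + 1) := by
      rw [← sub_nonneg]
      have : m / (↑T + 1) - (m / (T + 1 + 1) + κ * (m / (T + 1 + 1)) ^ 2) =
          m * ((T + 1 + 1) - (T + 1) * (κ * m)) / ((↑T + 1) * (↑T + 1 + 1) ^ 2) := by
        field_simp
        ring
      rw [this]
      apply div_nonneg _ (by positivity)
      apply mul_nonneg hmpos.le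
      have h1 : (T + 1 : ℝ) * (κ * m) ≤ (T + 1) * 1 :=
        mul_le_mul_of_nonneg_left (by rwa [mul_comm] at hmκ) hT0.le
      linarith
    linarith

/-- **Finite-trapezoid form** (what is usable at `b_δ`): for every `T ≥ 1` and every `L`, the `x_c`-mass
of self-avoiding walks from the entrance `a` of `S_{T,L}` to its far side `β` and oblique sides
`ε ∪ ε̄`, weighted `1` and `c_ε = cos(π/4)`, is at least `m/T`:
`B_{T,L} + c_ε E_{T,L} = 1 − c_α A_{T,L} ≥ 1 − c_α A_T ≥ m/T`.
[cite: DuminilCopinSmirnov2012, Lemma 2 and §3] -/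
theorem strip_escape_ge {T : ℕ} (hT : 1 ≤ T) (L : ℕ) :
    min (1 - Real.cos (3 * Real.pi / 8) * stripAlim 1)
        (Real.cos (3 * Real.pi / 8) * hexCriticalFugacity⁻¹)⁻¹ / T ≤
      stripB T L hexCriticalFugacity + Real.cos (Real.pi / 4) * stripE T L hexCriticalFugacity := by
  obtain ⟨T, rfl⟩ : ∃ T', T = T' + 1 := ⟨T - 1, by omega⟩
  have h := DuminilCopinSmirnov2012_lemma2_holds (T + 1) L hT
  have hA := stripA_le_lim DuminilCopinSmirnov2012_lemma2_holds hT L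
  have hG := escape_ge T
  have hc := cos_three_pi_div_eight_pos
  push_cast at hG ⊢
  nlinarith

end Literature.Probability.RandomPlanarGeometry.SAW
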